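import Summits.CriticalPhenomena.CardyFormulaZ2.Theses.CardySelfDualSegment
import Summits.CriticalPhenomena.CardyFormulaZ2.Theorems.CardySelfDualSegmentUniformBoxCrossingStubGlue
import Summits.CriticalPhenomena.CardyFormulaZ2.Theorems.CardySelfDualSegmentUniformBoxCrossingStubUpper
import Summits.CriticalPhenomena.CardyFormulaZ2.Theorems.CardySelfDualSegmentUniformBoxCrossingStubRender
import Summits.CriticalPhenomena.CardyFormulaZ2.Theorems.CardySelfDualSegmentUniformBoxCrossingStubDiagWOne
import Summits.CriticalPhenomena.CardyFormulaZ2.Theorems.CardySelfDualSegmentUniformBoxCrossingStubHardWayOfDiag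
import Summits.CriticalPhenomena.CardyFormulaZ2.Theorems.CardySelfDualSegmentUniformBoxCrossingStubDiagUZeroDict
import Summits.CriticalPhenomena.CardyFormulaZ2.Theorems.CardySelfDualSegmentUniformBoxCrossingStubDiagUZeroSite
import Summits.CriticalPhenomena.CardyFormulaZ2.Theorems.CardySelfDualSegmentUniformBoxCrossingStubDiagChain
import HarnessLib

/-!
# `UniformBoxCrossing` from endpoint domination / monotone chirality
(stmt-CriticalPhenomena-5476, line `Sketch`, continuation lead c4, 2026-08-17)

The conditional form of the reshaped line. The crux
`Summit.CriticalPhenomena.CardyFormulaZ2.Theses.CardySelfDualSegment.UniformBoxCrossing` (t-uniform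
box-crossing bounds for the corner family `M_t = cornerPercolation t`, `t ∈ [0,1]`) follows from
ENDPOINT DOMINATION for the 45°-turned 2:1 boxes of `ℤ²` — for every `t`, u-crossings of the turned
`m × 2m` boxes are at least as likely under `M_t` as under `M_0` (site percolation on the triangular
lattice of corners) and w-crossings of the turned `2m × m` boxes at least as likely as under `M_1`
(`P_{1/2}` bond percolation on `ℤ²`), eventually in `m`, at every integer position — and hence from
MONOTONE CHIRALITY (`t ↦ P_t(u-crossing)` non-decreasing, `t ↦ P_t(w-crossing)` non-increasing),
through the landed endpoint inputs (`stub_diagW_one`: bond-`ℤ²` RSW for turned boxes at `t = 1`;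
`stub_diagU_zero_site` + `stub_diagU_zero_dict`: site-`𝕋` RSW at `t = 0`), the fixed-`t` chaining
`stub_diagChain`, the zig-zag `stub_hardWay_of_diag`, and the landed Bollobás–Riordan tail
`stub_glue → stub_upper → stub_render`.

Both hypotheses are open (KERNEL-DOSSIER-c4 in the crux directory: they are the sign / the range of
the marginal Russo response of the tying perturbation, a spatially uniform stress-tensor density;
monotone chirality is exact for `m ≤ 3` and holds in Monte Carlo for `m = 4 … 1024`). Either says that
the large-scale anisotropy of `M_t` (principal axes on the diagonals) stays between `λ₁ = 1` and
`λ₀ = √3`.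
-/

namespace Summit.CriticalPhenomena.CardyFormulaZ2.Cruxes.UniformBoxCrossing.NonSlantLine

open MeasureTheory Complex Literature.Probability.Percolation Literature.Probability.LatticeModels
open Literature.Probability.Percolation.TrackExchange
open Summit.CriticalPhenomena.CardyFormulaZ2.Theses.CardySelfDualSegment

/-! ### Inputs (all landed under `Theorems/CardySelfDualSegmentUniformBoxCrossingStub*.lean`)

`stub_diagW_one` (t = 1 endpoint, p138489) · `stub_diagU_zero_site` (t = 0 endpoint, site side,
p138941) · `stub_diagU_zero_dict` (t = 0 dictionary, p138922) · `stub_diagChain` (2:1 ⇒ k:1 turned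
corridors at fixed t, p139127) · `stub_hardWay_of_diag` (zig-zag ⇒ hard-way axis 2:1, p138852) ·
`stub_glue`, `stub_upper`, `stub_render` (Bollobás–Riordan tail, p96953, p97268, p98410).

### Endpoint domination ⇒ the crux -/

/-- The endpoint bounds transported to every `t ∈ [0,1]` by endpoint domination: u-crossings of
the turned `m × 2m` boxes are bounded below by their `t = 0` value (site-`𝕋` RSW through the
dictionary), w-crossings of the turned `2m × m` boxes by their `t = 1` value (bond-`ℤ²` RSW). -/
theorem diag_bounds_of_endpointDomination
    (hED : ∃ m₁ : ℕ, ∀ m : ℕ, m₁ ≤ m → ∀ (A B : ℤ) (t : unitInterval),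
      (cornerPercolation 0).real (embTBCrossing (fun v => zDia v - ((A : ℂ) + (B : ℂ) * I)) m (2 * m)) ≤
        (cornerPercolation t).real (embTBCrossing (fun v => zDia v - ((A : ℂ) + (B : ℂ) * I)) m (2 * m)) ∧
      (cornerPercolation 1).real (embRectCrossing (fun v => zDia v - ((A : ℂ) + (B : ℂ) * I)) (2 * m) m) ≤
        (cornerPercolation t).real (embRectCrossing (fun v => zDia v - ((A : ℂ) + (B : ℂ) * I)) (2 * m) m)) :
    ∃ c : ℝ, 0 < c ∧ ∃ m₀ : ℕ, ∀ (t : unitInterval) (m : ℕ), m₀ ≤ m → ∀ A B : ℤ,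
      c ≤ (cornerPercolation t).real (embRectCrossing (fun v => zDia v - ((A : ℂ) + (B : ℂ) * I)) (2 * m) m) ∧
      c ≤ (cornerPercolation t).real (embTBCrossing (fun v => zDia v - ((A : ℂ) + (B : ℂ) * I)) m (2 * m)) := by
  obtain ⟨m₁, hED⟩ := hED
  obtain ⟨c₁, hc₁, m₂, hW⟩ := stub_diagW_one
  obtain ⟨c₀, hc₀, m₃, hU⟩ := stub_diagU_zero_site
  refine ⟨min c₀ c₁, lt_min hc₀ hc₁, max m₁ (max m₂ (max m₃ 1)), fun t m hm A B => ?_⟩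
  have hm₁ : m₁ ≤ m := le_trans (le_max_left _ _) hm
  have hm₂ : m₂ ≤ m := le_trans ((le_max_left _ _).trans (le_max_right _ _)) hm
  have hm₃ : m₃ ≤ m :=
    le_trans (((le_max_left _ _).trans (le_max_right _ _)).trans (le_max_right _ _)) hm
  have h1 : 1 ≤ m :=
    le_trans (((le_max_right _ _).trans (le_max_right _ _)).trans (le_max_right _ _)) hm
  obtain ⟨hUmono, hWmono⟩ := hED m hm₁ A B t
  constructor
  · calc min c₀ c₁ ≤ c₁ := min_le_right _ _
      _ ≤ _ := hW m hm₂ A B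
      _ ≤ _ := hWmono
  · calc min c₀ c₁ ≤ c₀ := min_le_left _ _
      _ ≤ _ := hU m hm₃ A B
      _ ≤ _ := stub_diagU_zero_dict m A B h1
      _ ≤ _ := hUmono

/-- **The crux from endpoint domination**: `UniformBoxCrossing`. The route's inlined `prm`, `cfg` are
literally `cornerParam`, `cornerConfig`, so the law is `cornerPercolation t`
(`cornerPercolation_def`); the chain endpoint domination + endpoints ⇒ t-uniform turned 2:1
bounds (`diag_bounds_of_endpointDomination`) ⇒ turned corridors (`stub_diagChain`) ⇒ hard-way `2:1` axis
crossings (`stub_hardWay_of_diag`) ⇒ all aspect ratios (`stub_glue`, landed) ⇒ two-sided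
(`stub_upper`, landed) ⇒ embedded box-crossing bounds (`stub_render`, landed) gives the claim. -/
theorem uniformBoxCrossing_of_endpointDomination
    (hED : ∃ m₁ : ℕ, ∀ m : ℕ, m₁ ≤ m → ∀ (A B : ℤ) (t : unitInterval),
      (cornerPercolation 0).real (embTBCrossing (fun v => zDia v - ((A : ℂ) + (B : ℂ) * I)) m (2 * m)) ≤
        (cornerPercolation t).real (embTBCrossing (fun v => zDia v - ((A : ℂ) + (B : ℂ) * I)) m (2 * m)) ∧
      (cornerPercolation 1).real (embRectCrossing (fun v => zDia v - ((A : ℂ) + (B : ℂ) * I)) (2 * m) m) ≤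
        (cornerPercolation t).real (embRectCrossing (fun v => zDia v - ((A : ℂ) + (B : ℂ) * I)) (2 * m) m)) :
    UniformBoxCrossing := by
  have hHW := stub_hardWay_of_diag (stub_diagChain (diag_bounds_of_endpointDomination hED))
  have hLB := stub_glue hHW
  have hbox := stub_render hLB (stub_upper hLB)
  show ∀ ρ : ℝ, 0 < ρ → ∃ c > 0, ∃ n₀ : ℕ, ∀ t : unitInterval,
    BoxCrossingBounds ((prodBernoulli (cornerParam t)).map cornerConfig) squareLatticeEmbedding.z ρ c n₀
  exact hbox

/-- **The crux from monotone chirality.** If for the turned 2:1 boxes `t ↦ P_t(u-crossing of the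
`m × 2m` box)` is non-decreasing and `t ↦ P_t(w-crossing of the `2m × m` box)` is non-increasing on
`[0,1]` (eventually in `m`, every integer position) — the registered kernel form of the dossiers,
exact for `m ≤ 3` — then endpoint domination holds (compare `t` with `0` and with `1`), hence
`UniformBoxCrossing`. -/
theorem uniformBoxCrossing_of_monotoneChirality
    (hMC : ∃ m₁ : ℕ, ∀ m : ℕ, m₁ ≤ m → ∀ (A B : ℤ) (t t' : unitInterval), t ≤ t' →
      (cornerPercolation t).real (embTBCrossing (fun v => zDia v - ((A : ℂ) + (B : ℂ) * I)) m (2 * m)) ≤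
        (cornerPercolation t').real (embTBCrossing (fun v => zDia v - ((A : ℂ) + (B : ℂ) * I)) m (2 * m)) ∧
      (cornerPercolation t').real (embRectCrossing (fun v => zDia v - ((A : ℂ) + (B : ℂ) * I)) (2 * m) m) ≤
        (cornerPercolation t).real (embRectCrossing (fun v => zDia v - ((A : ℂ) + (B : ℂ) * I)) (2 * m) m)) :
    UniformBoxCrossing := by
  obtain ⟨m₁, hMC⟩ := hMC
  refine uniformBoxCrossing_of_endpointDomination ⟨m₁, fun m hm A B t => ?_⟩
  have h0t : (0 : unitInterval) ≤ t := Subtype.coe_le_coe.1 t.2.1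
  have ht1 : t ≤ (1 : unitInterval) := Subtype.coe_le_coe.1 t.2.2
  exact ⟨(hMC m hm A B 0 t h0t).1, (hMC m hm A B t 1 ht1).2⟩

end Summit.CriticalPhenomena.CardyFormulaZ2.Cruxes.UniformBoxCrossing.NonSlantLine
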